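import Mathlib
import HarnessLib
import Literature.MathematicalPhysics.StatisticalMechanics.TorusFRDModeData
import Literature.MathematicalPhysics.StatisticalMechanics.TorusFRDHolds

/-!
# The per-mode data of the torus finite-range decomposition, from the named fact `TorusFRD`
# (Buchholz Thm 2.4 / Adams–Buchholz–Kotecký–Müller Thm 6.1, identity coefficient matrix)

`TorusFRDModeData.lean` turns clauses (o), (ii), (v) of `GradientFRD.TorusFRD` — stated there as
hypotheses on a kernel family — into the per-mode inputs of the weight tower
(`hshell`, `hinv`, evenness, zero-mode vanishing of `dominated_frdWeightData`).  This file discharges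
those hypotheses from the fact itself (`TorusFRD_holds`) for the identity coefficient matrix
`A = 1 ∈ 𝓛(½, 2)`: **`exists_frd_mode_data`** — for `d ≥ 3` and `n < ñ` there are kernels
`𝒞 L N M k` and constants `c > 0`, `C ≥ 0` such that for every odd `L > 3`, `N ≥ 1`, `M = L^N`:
zero sums and evenness, finite range (verbatim (iii)), the per-mode shell data with `ShellBoundsV`,
the symbol inversion `(Σ_j cExt)·|q|² … = 1`, and evenness / zero-mode vanishing of the coefficients.

Everything is proved; no named fact (uses `TorusFRD_holds`).

## References
* S. Buchholz, J. Funct. Anal. 275 (2018), Thm 2.4 [Buchholz2016].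
* S. Adams, S. Buchholz, R. Kotecký, S. Müller, arXiv:1910.13564, Thm 6.1 [AdamsBuchholzKoteckyMuller2019].
-/

noncomputable section

namespace Literature.MathematicalPhysics.StatisticalMechanics.GradientFRD

open Finset

variable {d : ℕ}

/-- The identity coefficient matrix is `(½, 2)`-elliptic. [cite: Buchholz2016, Sec. 2 (the class 𝓛(ω₀,Ω₀))] -/
theorem isElliptic_one : IsElliptic (1 / 2 : ℝ) 2 (1 : Matrix (Fin d) (Fin d) ℝ) := by
  refine ⟨Matrix.isSymm_one, fun z => ?_⟩
  have h : ∑ i, ∑ j, z i * (1 : Matrix (Fin d) (Fin d) ℝ) i j * z j = ∑ i, z i ^ 2 := by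
    refine sum_congr rfl fun i _ => ?_
    rw [Finset.sum_eq_single i (fun j _ hji => by rw [Matrix.one_apply_ne (Ne.symm hji)]; ring)
      (fun h => (h (mem_univ i)).elim), Matrix.one_apply_eq]; ring
  rw [h]
  have : 0 ≤ ∑ i, z i ^ 2 := by positivity
  constructor <;> linarith

/-- **Per-mode data of the finite-range decomposition of `(−Δ)⁻¹` on `(ℤ/L^N)^d`** from
`TorusFRD_holds`: kernels `𝒞 L N M k` (`k = 1,…,N+1`) and constants `c > 0`, `C ≥ 0` with, for every
odd `L > 3`, `N ≥ 1`, `M = L^N`: (o) zero sums and evenness; (iii) finite range; the per-mode shell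
data `∃ j' ≤ N, InShell L j' κ ∧ ShellBoundsV d n ñ N j' L c C (𝒞̂_·(κ))` for `κ ≠ 0`; the symbol
inversion `(Σ_{j=1}^{N+1} cExt N (𝒞̂_·(κ)) j)·â(κ) = 1` (`A = 1`); evenness and zero-mode vanishing of
`cExt`. [cite: AdamsBuchholzKoteckyMuller2019, Thm 6.1] -/
theorem exists_frd_mode_data (hd : 3 ≤ d) {n ñ : ℕ} (hn : n < ñ) :
    ∃ (𝒞 : (L N M : ℕ) → ℕ → (Fin d → ZMod M) → ℝ) (Mc : ℕ → ℕ → ℕ → ℝ) (c C : ℝ), 0 < c ∧ 0 ≤ C ∧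
      ∀ L : ℕ, Odd L → 3 < L → ∀ N : ℕ, 1 ≤ N → ∀ (M : ℕ) [NeZero M], M = L ^ N →
        (∀ k ∈ Icc 1 (N + 1), ∑ x : Fin d → ZMod M, 𝒞 L N M k x = 0 ∧ ∀ x, 𝒞 L N M k (-x) = 𝒞 L N M k x) ∧
        (∀ k, 1 ≤ k → k ≤ N → Mc L N k ≤ 0 ∧
          ∀ x : Fin d → ZMod M, ((L : ℝ) ^ k) / 2 ≤ (supNorm x : ℝ) → 𝒞 L N M k x = Mc L N k) ∧
        (∀ κ : Fin d → ZMod M, κ ≠ 0 → ∃ j', j' ≤ N ∧ InShell L j' κ ∧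
          ShellBoundsV d n ñ N j' (L : ℝ) c C (fun j => fourierCoeff (𝒞 L N M j) κ)) ∧
        (∀ κ : Fin d → ZMod M, κ ≠ 0 →
          (∑ j ∈ Icc 1 (N + 1), cExt N (fun j => fourierCoeff (𝒞 L N M j) κ) j) *
            symbR (1 : Matrix (Fin d) (Fin d) ℝ) κ = 1) ∧
        (∀ (κ : Fin d → ZMod M) (j : ℕ), cExt N (fun j => fourierCoeff (𝒞 L N M j) (-κ)) j =
          cExt N (fun j => fourierCoeff (𝒞 L N M j) κ) j) ∧
        (∀ j : ℕ, cExt N (fun j => fourierCoeff (𝒞 L N M j) (0 : Fin d → ZMod M)) j = 0) := by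
  obtain ⟨𝒞, Mc, Cα, c, C, Cℓ, hc, hall⟩ :=
    TorusFRD_holds d hd (1 / 2) 2 (by norm_num) (by norm_num) n ñ hn
  refine ⟨fun L N M k => 𝒞 L N M 1 k, Mc, c, max C 0, hc, le_max_right _ _, ?_⟩
  intro L hLodd hL3 N hN M _ hM
  obtain ⟨ho, hi, hii, hiii, hiv, hv⟩ := hall L hLodd hL3 N hN M hM 1 isElliptic_one
  have hL5 : 5 ≤ L := by
    obtain ⟨m, hm⟩ := hLodd; omega
  have hLr0 : (0 : ℝ) ≤ (L : ℝ) := by positivity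
  -- (o)
  have ho' : ∀ k ∈ Icc 1 (N + 1), ∑ x : Fin d → ZMod M, 𝒞 L N M 1 k x = 0 ∧
      ∀ x, 𝒞 L N M 1 k (-x) = 𝒞 L N M 1 k x := fun k hk => by
    rw [mem_Icc] at hk; exact ho k hk.1 hk.2
  -- (v) without the derivative bounds, with `C` replaced by `max C 0`
  have hv' : ∀ k, 1 ≤ k → k ≤ N + 1 → ∀ j : ℕ, ∀ κ : Fin d → ZMod M, κ ≠ 0 → InShell L j κ →
      (j < k →
        c / (L : ℝ) ^ (2 * (d + ñ) + 1) * (L : ℝ) ^ (2 * j) / (L : ℝ) ^ ((k - j) * (d - 1 + n)) ≤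
            (fourierCoeff (𝒞 L N M 1 k) κ).re ∧
          ‖fourierCoeff (𝒞 L N M 1 k) κ‖ ≤
            max C 0 * (L : ℝ) ^ (2 * (d + ñ) + 1) * (L : ℝ) ^ (2 * j) / (L : ℝ) ^ ((k - j) * (d - 1 + n))) ∧
      (k ≤ j →
        c / (L : ℝ) ^ (2 * (d + ñ) + 1) * (L : ℝ) ^ (2 * k) ≤ (fourierCoeff (𝒞 L N M 1 k) κ).re ∧
          ‖fourierCoeff (𝒞 L N M 1 k) κ‖ ≤ max C 0 * (L : ℝ) ^ (2 * k)) := by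
    intro k hk1 hkN j κ hκ hj
    obtain ⟨h1, h2, -⟩ := hv k hk1 hkN j κ hκ hj
    refine ⟨fun hjk => ⟨(h1 hjk).1, (h1 hjk).2.trans ?_⟩, fun hkj => ⟨(h2 hkj).1, (h2 hkj).2.trans ?_⟩⟩
    · exact div_le_div_of_nonneg_right (mul_le_mul_of_nonneg_right
        (mul_le_mul_of_nonneg_right (le_max_left _ _) (by positivity)) (by positivity)) (by positivity)
    · exact mul_le_mul_of_nonneg_right (le_max_left _ _) (by positivity)
  refine ⟨ho', hiii, fun κ hκ => exists_shell_and_bounds hL5 hM hv' κ hκ, fun κ hκ => ?_,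
    fun κ j => cExt_fourierCoeff_neg (fun k hk => (ho' k hk).2) κ j,
    fun j => cExt_fourierCoeff_zero_mode (fun k hk => (ho' k hk).1) j⟩
  exact sum_cExt_mul_symbR_eq_one Matrix.isSymm_one (fun k hk => (ho' k hk).2) hii hκ

end Literature.MathematicalPhysics.StatisticalMechanics.GradientFRD

end
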